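import Mathlib.RingTheory.IntegralClosure.Algebra.Basic
import Mathlib.RingTheory.IntegralClosure.IsIntegral.Basic
import Mathlib.LinearAlgebra.Eigenspace.Minpoly
import Mathlib.RingTheory.Finiteness.Basic
import Literature.NumberTheory.EllipticCurves.HeckeOperators
import HarnessLib

/-!
# Integrality of the Hecke operators `T_p` on `S_k(Γ₀(N))` and of their eigenvalues
# (Shimura 1971, Thm. 3.48; the Hecke-stable lattice (3.5.20))

The source result. Shimura, *Introduction to the arithmetic theory of automorphic functions*
(1971), Thm. 3.48: for a group `Γ'` of type (3.3.2) (this includes `Γ₀(N)` and `Γ₁(N)`) and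
`k ≥ 2`, with `𝔅 ⊇ R(Γ', Δ')` the ring of double cosets `Γ'αΓ'`, `α` an integer matrix of
positive determinant (invariant under `ε = diag(-1, 1)`, see (3.5.19)), and `B₀` the `ℚ`-algebra
generated by the operators `[X]_k`, `X ∈ 𝔅`, on `S_k(Γ')`:
*(1) `B₀` is a semisimple algebra of finite rank; (2) `B = B₀ ⊗_ℚ ℂ`; (3) the characteristic
polynomial of `[X]_k` for every `X ∈ 𝔅` has rational integral coefficients.* The proof of (3)
rests on **(3.5.20)**: *there is a discrete `ℤ`-submodule `L` of `S_k(Γ')` of maximal rank which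
is stable under the `[Γ'αΓ']_k` for all `α ∈ Δ`* (`Δ = {α ∈ M₂(ℤ) | det α > 0}`), which Shimura
proves in §8.4 (last paragraph) from the Eichler–Shimura isomorphism
`H¹_P(Γ, ℝ^{k-1}) ≅ S_k(Γ)` (Thm. 8.4, Prop. 8.5) and the integral parabolic cohomology lattice
(Prop. 8.6): "we obtain a lattice `L` of `S_{n+2}(Γ)` which is stable under `(ΓαΓ)_{n+2}` for
every `α ∈ M₂(ℤ) ∩ GL₂⁺(ℝ)`. This proves the statement (3.5.20)". Given the lattice, (3) is
linear algebra: `[X]_k` is represented by an integer matrix on a `ℤ`-basis of `L` (end of the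
proof of Thm. 3.48: "`ξ` sends the lattice `L` into itself, so that `ρ₀(ξ) ∈ M_{2r}(ℤ)`").

This file (namespace `Literature.ModularForms`):

* `Shimura1971_heckeStableLattice N k` — the **named fact** (3.5.20) for `Γ' = Γ₀(N)`, in the
  form "there is a finitely generated `ℤ`-submodule of `S_k(Γ₀(N))` spanning it over `ℂ` and
  stable under `cuspHeckeOperatorₗ (Gamma0 N) k g` for every `g ∈ GL₂⁺(ℚ)` with integer entries"
  (see its docstring for the comparison with the printed statement). Not proved here
  (Eichler–Shimura theory; Mathlib has neither the finite-dimensionality of `S_k(Γ₀(N))` nor any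
  integral structure on it).
* `isIntegral_of_mapsTo_lattice` — the **lattice argument**, proved in general: a `ℂ`-linear
  endomorphism of a vector space `V` mapping a finitely generated `ℤ`-submodule `L` with
  `span_ℂ L = V` into itself is integral over `ℤ` (`latticeStabilizer L →+* End_ℤ(L)` is an
  injective ring map into an algebra that is integral over `ℤ` by Cayley–Hamilton,
  `Module.End.isIntegral`); and `isIntegral_eigenvalue`: eigenvalues (on nonzero eigenvectors) of
  an endomorphism integral over `ℤ` are algebraic integers.
* `heckeT_isIntegral` — **Thm. 3.48(3) for `X = Γ₀(N) diag(1, p) Γ₀(N)`**, derived from the named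
  fact: for `k ≥ 2` and every `p ≥ 1`, `T_p = heckeT (Gamma0 N) k p` (`= U_p` when `p ∣ N`) is
  integral over `ℤ`; `isIntegral_of_heckeT_apply_eq_smul` — **Hecke eigenvalues on `S_k(Γ₀(N))`
  are algebraic integers** (cf. Diamond–Shurman Thm. 6.5.1 in weight `2`, whose proof is this lattice
  argument with the lattice `H₁(X₁(N), ℤ)`).

These feed the integrality of the Fourier coefficients of normalised eigenforms / newforms
(`IsNewform0.isIntegral_coeff` of `Newforms`), see `NewformsIntegralityProofs`.

## Normalisations

Shimura's `f|[ξ]_k = det(ξ)^{k/2} f(ξz) j(ξ, z)^{-k}` (§3.4, before (3.4.1)) and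
`f|[Γ₁αΓ₂]_k = det(α)^{k/2-1} Σ_ν f|[α_ν]_k`, `Γ₁αΓ₂ = ⊔_ν Γ₁α_ν` ((3.4.1)) give the total factor
`det(α_ν)^{k-1} j(α_ν, z)^{-k}`, which is exactly Mathlib's slash action (`ModularForm.slash_def`,
`|det|^{k-1}`) summed over the same cosets in `cuspHeckeOperatorₗ` (see the module docstring of
`HeckeOperators`, and `coe_cuspHeckeCorrespondence_eq_sum` in `HeckeOperatorsDoubleCoset`). Hence
Shimura's `[Γ₀(N) diag(1, p) Γ₀(N)]_k` is `heckeT (Gamma0 N) k p`.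

## References

* G. Shimura, *Introduction to the arithmetic theory of automorphic functions*, Publ. Math. Soc.
  Japan 11, Iwanami Shoten / Princeton University Press, 1971: §3.3 ((3.3.2), (3.3.3), `Δ`),
  (3.4.1), §3.5 Thm. 3.48, (3.5.19), (3.5.20), Lemma 3.49, Thm. 3.51, Thm. 3.52; §8.4.
* F. Diamond, J. Shurman, *A first course in modular forms*, GTM 228, Springer, 2005, §6.5
  (Thm. 6.5.1, Cor. 6.5.6).
-/

noncomputable section

open scoped MatrixGroups ModularForm

open CongruenceSubgroup

namespace Literature.NumberTheory.EllipticCurves.ModularForms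

/-! ### Endomorphisms preserving a spanning lattice are integral over `ℤ` -/

section Lattice

variable {V : Type*} [AddCommGroup V] [Module ℂ V]

/-- The `ℤ`-subalgebra of `End_ℂ(V)` consisting of the endomorphisms that map a given
`ℤ`-submodule `L ≤ V` into itself (the order `{ξ | ξ L ⊆ L}` of Shimura 1971, proof of
Thm. 3.52). [folklore] -/
def latticeStabilizer (L : Submodule ℤ V) : Subalgebra ℤ (Module.End ℂ V) where
  carrier := {T | ∀ v ∈ L, T v ∈ L}
  mul_mem' hS hT v hv := hS _ (hT v hv)
  one_mem' v hv := hv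
  add_mem' hS hT v hv := L.add_mem (hS v hv) (hT v hv)
  zero_mem' v hv := by simp
  algebraMap_mem' n v hv := by
    rw [algebraMap_int_eq, eq_intCast, Module.End.intCast_apply]
    exact L.smul_mem n hv

/-- Membership in `latticeStabilizer L` (unfolding lemma). [folklore] -/
@[simp] lemma mem_latticeStabilizer {L : Submodule ℤ V} {T : Module.End ℂ V} :
    T ∈ latticeStabilizer L ↔ ∀ v ∈ L, T v ∈ L :=
  Iff.rfl

/-- Restriction of a lattice-stabilising `ℂ`-linear endomorphism to the lattice, as a ring
homomorphism `{T | T L ⊆ L} →+* End_ℤ(L)` (the representation `ρ₀` of Shimura 1971, proof of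
Thm. 3.48). [folklore] -/
def restrictToLattice (L : Submodule ℤ V) : latticeStabilizer L →+* Module.End ℤ L where
  toFun T := ((T : Module.End ℂ V) : V →ₗ[ℂ] V).toAddMonoidHom.toIntLinearMap.restrict
    (p := L) (q := L) fun v hv ↦ T.2 v hv
  map_one' := by ext; rfl
  map_mul' _ _ := by ext; rfl
  map_zero' := by ext; rfl
  map_add' _ _ := by ext; rfl

/-- Unfolding lemma for `restrictToLattice`. [folklore] -/
@[simp] lemma restrictToLattice_apply_coe (L : Submodule ℤ V) (T : latticeStabilizer L) (v : L) :
    ((restrictToLattice L T v : L) : V) = (T : Module.End ℂ V) v :=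
  rfl

/-- If `L` spans `V` over `ℂ`, an endomorphism stabilising `L` is determined by its restriction
to `L`. [folklore] -/
lemma restrictToLattice_injective {L : Submodule ℤ V}
    (hL : Submodule.span ℂ (L : Set V) = ⊤) : Function.Injective (restrictToLattice L) := by
  intro S T hST
  apply Subtype.ext
  refine LinearMap.ext_on hL fun v hv ↦ ?_
  simpa using congrArg (fun φ : Module.End ℤ L ↦ ((φ ⟨v, hv⟩ : L) : V)) hST

/-- **Lattice argument** (Shimura 1971, proof of Thm. 3.48(3)): a `ℂ`-linear endomorphism of
`V` that maps a finitely generated `ℤ`-submodule `L` spanning `V` over `ℂ` into itself is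
integral over `ℤ` (it satisfies the monic integer polynomial given by Cayley–Hamilton on `L`). [folklore] -/
theorem isIntegral_of_mapsTo_lattice {L : Submodule ℤ V} (hfg : L.FG)
    (hL : Submodule.span ℂ (L : Set V) = ⊤) {T : Module.End ℂ V} (hT : ∀ v ∈ L, T v ∈ L) :
    IsIntegral ℤ T := by
  haveI : Module.Finite ℤ L := Module.Finite.iff_fg.mpr hfg
  have h1 : IsIntegral ℤ ((restrictToLattice L).toIntAlgHom ⟨T, hT⟩) :=
    Algebra.IsIntegral.isIntegral _
  have h2 : IsIntegral ℤ (⟨T, hT⟩ : latticeStabilizer L) :=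
    (isIntegral_algHom_iff _ (restrictToLattice_injective hL)).mp h1
  exact h2.map (latticeStabilizer L).val

/-- An eigenvalue of an endomorphism integral over `ℤ` (on a nonzero eigenvector) is an
algebraic integer. [folklore] -/
theorem isIntegral_eigenvalue {T : Module.End ℂ V} (hT : IsIntegral ℤ T) {f : V} (hf : f ≠ 0)
    {a : ℂ} (h : T f = a • f) : IsIntegral ℤ a := by
  obtain ⟨p, hp, hpT⟩ := hT
  have hpT' : Polynomial.aeval T p = 0 := hpT
  refine ⟨p, hp, ?_⟩
  have key := Module.End.aeval_apply_of_hasEigenvector (f := T) (p := p.map (algebraMap ℤ ℂ))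
    (μ := a) (x := f) ⟨Module.End.mem_eigenspace_iff.mpr h, hf⟩
  have hmap : Polynomial.aeval T (p.map (algebraMap ℤ ℂ)) = Polynomial.aeval T p := by
    rw [Polynomial.aeval_def, Polynomial.eval₂_map,
      RingHom.ext_int ((algebraMap ℂ (Module.End ℂ V)).comp (algebraMap ℤ ℂ)) (algebraMap ℤ _),
      ← Polynomial.aeval_def]
  rw [hmap, hpT', LinearMap.zero_apply, eq_comm, smul_eq_zero] at key
  rcases key with h0 | h0
  · rw [Polynomial.eval_map] at h0
    exact h0
  · exact absurd h0 hf

end Lattice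

/-! ### Shimura's Hecke-stable lattice; integrality of `T_p` and of its eigenvalues -/

section Shimura

variable (N : ℕ) [NeZero N] (k : ℤ)

/-- **Shimura's Hecke-stable lattice in `S_k(Γ₀(N))`** (named fact). For `k ≥ 2` there is a
finitely generated `ℤ`-submodule `L` of `S_k(Γ₀(N))` which spans `S_k(Γ₀(N))` over `ℂ` and is
mapped into itself by every double-coset operator `[Γ₀(N) α Γ₀(N)]_k` with `α` an integer
matrix of positive determinant — in particular by every `T_p = [Γ₀(N) diag(1, p) Γ₀(N)]`
(`heckeT`, including `U_p` for `p ∣ N`). This is statement (3.5.20) of Shimura (1971), on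
which the proof of Thm. 3.48 rests: *"There is a discrete `ℤ`-submodule `L` of `S_k(Γ')` of
maximal rank which is stable under the `[Γ'αΓ']_k` for all `α ∈ Δ`"* (`Γ'` a group of type
(3.3.2), e.g. `Γ₀(N)`; `Δ = {α ∈ M₂(ℤ) | det α > 0}`, §3.3; `k ≥ 2` as in Thm. 3.48), proved in
§8.4 (last paragraph) from the Eichler–Shimura isomorphism (Thm. 8.4, Prop. 8.5) and the
integral parabolic cohomology lattice (Prop. 8.6). **Recorded form.** We record the two
consequences of "discrete of maximal rank" that are used downstream — `L` is finitely
generated, and its `ℂ`-span is all of `S_k(Γ₀(N))` (a discrete subgroup of the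
finite-dimensional real vector space `S_k(Γ')` is finitely generated; maximal rank means its
`ℝ`-span, hence its `ℂ`-span, is everything) — instead of discreteness itself (which would need
a topology on `CuspForm Γ k`); so this `Prop` is implied by, and formally slightly weaker than,
the printed (3.5.20). Shimura's `[Γ'αΓ']_k f = det(α)^{k/2-1} Σ_ν f|[α_ν]_k` ((3.4.1), with
`f|[ξ]_k = det(ξ)^{k/2} f(ξz) j(ξ, z)^{-k}`, the display preceding it in §3.4) carries the total factor `det^{k-1}`, exactly
as Mathlib's slash action inside `cuspHeckeOperatorₗ` (see the module docstring of
`HeckeOperators`). [cite: Shimura1971, (3.5.20) in the proof of Thm. 3.48, proved in §8.4] -/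
def Shimura1971_heckeStableLattice : Prop :=
  2 ≤ k → ∃ L : Submodule ℤ (CuspForm (Gamma0 N) k),
    L.FG ∧ Submodule.span ℂ (L : Set (CuspForm (Gamma0 N) k)) = ⊤ ∧
      ∀ g : GL(2, ℚ)⁺,
        (∀ i j, ∃ z : ℤ, ((g : GL (Fin 2) ℚ) : Matrix (Fin 2) (Fin 2) ℚ) i j = z) →
          ∀ f ∈ L, cuspHeckeOperatorₗ (Gamma0 N) k g f ∈ L

variable {N k}

/-- The diagonal matrix `diag(1, p)` defining `T_p` has integer entries. [folklore] -/
lemma exists_int_diagGL_one (p : ℕ) [NeZero p] (i j : Fin 2) :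
    ∃ z : ℤ, ((diagGL 1 p one_pos (Nat.cast_pos.mpr (NeZero.pos p)) : GL (Fin 2) ℚ) :
      Matrix (Fin 2) (Fin 2) ℚ) i j = z := by
  rw [coe_coe_diagGL]
  fin_cases i <;> fin_cases j
  exacts [⟨1, by simp⟩, ⟨0, by simp⟩, ⟨0, by simp⟩, ⟨p, by simp⟩]

/-- **Shimura 1971, Thm. 3.48(3)** (for the double coset `Γ₀(N) diag(1, p) Γ₀(N)`), derived
from the lattice fact: for `k ≥ 2` and every `p ≥ 1` the operator `T_p` (`= U_p` if `p ∣ N`)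
on `S_k(Γ₀(N))` is integral over `ℤ`, i.e. satisfies a monic polynomial with integer
coefficients (Shimura: "the characteristic polynomial of `[X]_k` for every `X ∈ 𝔅` has
rational integral coefficients"; `Γ' diag(1, p) Γ' ∈ R(Γ', Δ') ⊆ 𝔅` by (3.5.19)). [cite: Shimura1971, Thm. 3.48(3)] -/
theorem heckeT_isIntegral (hL : Shimura1971_heckeStableLattice N k) (hk : 2 ≤ k) (p : ℕ)
    [NeZero p] : IsIntegral ℤ (heckeT (Gamma0 N) k p) := by
  obtain ⟨L, hfg, hspan, hstab⟩ := hL hk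
  exact isIntegral_of_mapsTo_lattice hfg hspan fun f hf ↦
    hstab (diagGL 1 p one_pos (Nat.cast_pos.mpr (NeZero.pos p))) (exists_int_diagGL_one p) f hf

/-- **Hecke eigenvalues are algebraic integers** (Shimura 1971, Thm. 3.48(3): an eigenvalue of
`[X]_k` is a root of its characteristic polynomial, which is monic with integer
coefficients; cf. Diamond–Shurman Thm. 6.5.1 for weight `2`): if
`0 ≠ f ∈ S_k(Γ₀(N))`, `k ≥ 2`, and `T_p f = a f` for some `p ≥ 1`, then `a` is an algebraic
integer. Derived from the lattice fact `Shimura1971_heckeStableLattice`. [cite: Shimura1971, Thm. 3.48(3)] -/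
theorem isIntegral_of_heckeT_apply_eq_smul (hL : Shimura1971_heckeStableLattice N k)
    (hk : 2 ≤ k) {p : ℕ} [NeZero p] {f : CuspForm (Gamma0 N) k} (hf : f ≠ 0) {a : ℂ}
    (h : heckeT (Gamma0 N) k p f = a • f) : IsIntegral ℤ a :=
  isIntegral_eigenvalue (heckeT_isIntegral hL hk p) hf h

end Shimura

end Literature.NumberTheory.EllipticCurves.ModularForms
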